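import Literature.AlgebraicGeometry.Modules.VanishingLocusOfHom
import Literature.AlgebraicGeometry.Modules.IdealSheafOfClosedImmersion
import Literature.AlgebraicGeometry.Modules.PullbackSectionsBaseChange
import Literature.AlgebraicGeometry.Modules.LocalFrames
import Literature.AlgebraicGeometry.Modules.PushforwardClosedImmersionCoh
import Literature.AlgebraicGeometry.Modules.AffineVectorBundleSections
import HarnessLib

/-!
# Containment `X_T ⊆ Z_T` on an affine frame chart of a finite locally free `X → S` (the chart algebra)

Topic `Literature/AlgebraicGeometry/Morphisms`; theorems only (no definition, no named fact, no instance, no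
`sorry`).  Cell hodgecm-mathlib, F-DAG (h6): the FINITE-FLAT discharge of the sheaf socket `hrep` of ★
`Morphisms/ContainmentLocusClosed` (file 2 of 3; file 1 = ★ `Morphisms/IdealSheafLeKerLocal`, file 3 =
`Morphisms/ContainmentLocusFiniteFlat`).  HC_CM is proved only modulo the 7 printed citations until rung 0 closes;
nothing here is about HC.

Let `p : X ⟶ S` be AFFINE with `p_*𝒪_X` finite locally free (GW I Def. 12.18: finite locally free morphism), `𝓘` an
ideal sheaf on `X` (`Z = V(𝓘)`), and `u := p_*(𝓘_Z ↪ 𝒪_X) : p_*𝓘_Z ⟶ p_*𝒪_X` (★ `Modules/IdealSheafOfClosedImmersion`,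
Mathlib `Scheme.Modules.pushforward`) — a morphism from a quasi-coherent module into a VECTOR BUNDLE on `S`, so that
★ `Modules/VanishingLocusOfHom` provides its vanishing locus `V(u) ⊆ S`.  On an affine open `W = Spec A ⊆ S` over
which `p_*𝒪_X` is FREE (a frame `e : 𝒪_W^ι ≅ (p_*𝒪_X)|_W`; `B := Γ(X, p⁻¹W)` is then a free `A`-module with basis the
frame sections) and an affine `V' = Spec A' ⊆ T` mapping into `W` under `b : T ⟶ S`, the piece
`O := pr⁻¹(p⁻¹W) ∩ p_T⁻¹(V')` of `X ×_S T` is affine with `Γ(O) = A' ⊗_A B` (★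
`Modules/PullbackSectionsBaseChange.isPushout_sections_of_isPullback`), and:

  «`pr^♯ : B → A' ⊗_A B` kills `𝓘(p⁻¹W)`»  ⟺  «`b^♯ : A → A'` kills the ideal of values `V(u)(W)`»

(`appLE_fst_eq_zero_iff_appLE_vanishingIdeal_eq_zero`): `x ⊗ 1 = 0` for `x ∈ 𝓘(p⁻¹W)` iff every coordinate / every
`A`-linear functional value of `x` dies in `A'` (§1, elementary: `x = Σᵢ λᵢ(x) bᵢ` in the frame one way,
`(λ ⊗ 1)(x ⊗ 1) = λ(x) ⊗ 1` the other), and the values `μ_W(x)` of local functionals `μ : (p_*𝒪_X)|_W → 𝒪_W` on sections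
`x` of `p_*𝓘_Z` are exactly the generators of `V(u)(W)` (★ `vanishingIdeal_ideal`).  File 3 assembles these charts with
★ `IdealSheafLeKerLocal.le_ker_iff_of_affine_charts` into `𝓘 ≤ pr.ker ↔ V(u) ≤ b.ker ↔ b^*u = 0` (= `hrep`).

* §1 `one_tmul_eq_zero_of_eq_sum`, `algebraMap_eq_zero_of_one_tmul_eq_zero` (pure algebra);
* §2 `exists_affine_frame_of_finite_projective_app` (affine frame charts of `p_*𝒪_X` from finite projective
  `Γ(X, p⁻¹W)`, ★ `exists_free_over_basicOpen_of_projective_sections`);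
* §3 `appLE_fst_eq_zero_iff_appLE_vanishingIdeal_eq_zero` (the chart equivalence).

## References
* [GortzWedhorn2020] U. Görtz, T. Wedhorn, *Algebraic Geometry I: Schemes*, 2nd ed. (2020): Definition 12.18 and
  Proposition 12.19 (pp. 331–332) (finite locally free morphisms), (4.5), Prop. 4.16 (pp. 101–104) (fibre products of
  affine schemes), Cor. 7.42 (vector bundles on affine schemes ↔ finite projective modules), Section (4.11).
* [MumfordFogartyKirwan1994] D. Mumford, J. Fogarty, F. Kirwan, *Geometric Invariant Theory*, 3rd ed. (1994), Ch. 6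
  §3 Prop. 6.16 (p. 126) (closed conditions via a map into a locally free sheaf).
-/

noncomputable section

-- `TopCat.Presheaf`/`Scheme.Modules` are not reducible (as in Mathlib's `AlgebraicGeometry/Modules`).
set_option backward.isDefEq.respectTransparency false

open CategoryTheory CategoryTheory.Limits AlgebraicGeometry TopologicalSpace Opposite TensorProduct

universe u

namespace Literature.AlgebraicGeometry.Morphisms

open Literature.AlgebraicGeometry.Modules Literature.AlgebraicGeometry.Motives

/-! ## §1 The algebra: `1 ⊗ x = 0` in `A' ⊗_A B` versus the coordinates of `x` -/

section Algebra

variable {A A' B : Type*} [CommRing A] [CommRing A'] [CommRing B] [Algebra A A'] [Algebra A B]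

/-- If `x = Σᵢ cᵢ · vᵢ` with coefficients `cᵢ ∈ A` that die in `A'`, then `1 ⊗ x = 0` in `A' ⊗_A B`.
[cite: GortzWedhorn2020, Cor. 7.42] -/
theorem one_tmul_eq_zero_of_eq_sum {ι : Type*} (t : Finset ι) (c : ι → A) (v : ι → B) (x : B)
    (hx : x = ∑ i ∈ t, algebraMap A B (c i) * v i) (hc : ∀ i ∈ t, algebraMap A A' (c i) = 0) :
    (1 : A') ⊗ₜ[A] x = 0 := by
  rw [hx, TensorProduct.tmul_sum]
  refine Finset.sum_eq_zero fun i hi => ?_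
  rw [← Algebra.smul_def, TensorProduct.tmul_smul, TensorProduct.smul_tmul', Algebra.smul_def, mul_one, hc i hi,
    TensorProduct.zero_tmul]

/-- If `1 ⊗ x = 0` in `A' ⊗_A B`, every `A`-linear functional value `λ(x)` dies in `A'`
(`(1 ⊗ λ)(1 ⊗ x) = 1 ⊗ λ(x) ↦ λ(x) · 1` under `A' ⊗_A A ≅ A'`). [cite: GortzWedhorn2020, Cor. 7.42] -/
theorem algebraMap_eq_zero_of_one_tmul_eq_zero (lam : B →ₗ[A] A) (x : B) (hx : (1 : A') ⊗ₜ[A] x = 0) :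
    algebraMap A A' (lam x) = 0 := by
  have h := congrArg (lam.baseChange A') hx
  rw [LinearMap.baseChange_tmul, map_zero] at h
  have h2 := congrArg (TensorProduct.AlgebraTensorModule.rid A A' A') h
  rw [TensorProduct.AlgebraTensorModule.rid_tmul, map_zero] at h2
  rwa [Algebra.algebraMap_eq_smul_one]

end Algebra

/-! ## §2 Affine frame charts of `p_*𝒪_X` for `p` finite locally free -/

section Frames

variable {X S : Scheme.{u}} (p : X ⟶ S)

/-- **Affine frame charts.** If `p` is affine and every point of `S` has an affine neighbourhood `W` with `Γ(X, p⁻¹W)`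
finite projective over `Γ(S, W)` (GW I Def. 12.18 / Prop. 12.19: `p` finite locally free; e.g. `p` finite, flat and
of finite presentation), then every point of `S` has an AFFINE neighbourhood over which `p_*𝒪_X` is free of finite
rank (★ `exists_free_over_basicOpen_of_projective_sections` on a basic open of `W`).
[cite: GortzWedhorn2020, Definition 12.18 and Proposition 12.19 (pp. 331–332)] [cite: GortzWedhorn2020, Cor. 7.42] -/
theorem exists_affine_frame_of_finite_projective_app [IsAffineHom p]
    (hp : ∀ s : S, ∃ W : S.Opens, s ∈ W ∧ IsAffineOpen W ∧
      letI := (p.app W).hom.toAlgebra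
      Module.Finite Γ(S, W) Γ(X, p ⁻¹ᵁ W) ∧ Module.Projective Γ(S, W) Γ(X, p ⁻¹ᵁ W)) (s : S) :
    ∃ W : S.Opens, s ∈ W ∧ IsAffineOpen W ∧ ∃ (ι : Type u) (_ : Finite ι),
      Nonempty (SheafOfModules.free ι ≅ ((Scheme.Modules.pushforward p).obj (unitModule X)).over W) := by
  obtain ⟨W, hsW, hW, hfin, hproj⟩ := hp s
  letI : Algebra Γ(S, W) Γ(X, p ⁻¹ᵁ W) := (p.app W).hom.toAlgebra
  haveI : Module.Finite Γ(S, W) Γ((Scheme.Modules.pushforward p).obj (unitModule X), W) := hfin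
  haveI : Module.Projective Γ(S, W) Γ((Scheme.Modules.pushforward p).obj (unitModule X), W) := hproj
  have hloc : IsAffineLocalizing ((Scheme.Modules.pushforward p).obj (unitModule X)) :=
    isAffineLocalizing_pushforward_of_isAffineHom p IsAffineLocalizing.unit
  obtain ⟨r, hsr, ι, hι, e⟩ := exists_free_over_basicOpen_of_projective_sections hloc hW hsW
  exact ⟨S.basicOpen r, hsr, hW.basicOpen r, ι, hι, e⟩

/-- `p_*𝒪_X` is finite locally free under the same hypothesis (★
`IsFiniteLocallyFree.pushforward_of_finite_projective_app` at `𝒪_X`, restated from the affine charts).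
[cite: GortzWedhorn2020, Prop. 12.13 (p. 330)] -/
theorem isFiniteLocallyFree_pushforward_unit_of_finite_projective_app [IsAffineHom p]
    (hp : ∀ s : S, ∃ W : S.Opens, s ∈ W ∧ IsAffineOpen W ∧
      letI := (p.app W).hom.toAlgebra
      Module.Finite Γ(S, W) Γ(X, p ⁻¹ᵁ W) ∧ Module.Projective Γ(S, W) Γ(X, p ⁻¹ᵁ W)) :
    IsFiniteLocallyFree ((Scheme.Modules.pushforward p).obj (unitModule X)) := fun s => by
  obtain ⟨W, hsW, -, ι, hι, e⟩ := exists_affine_frame_of_finite_projective_app p hp s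
  exact ⟨W, hsW, ι, hι, e⟩

end Frames

/-! ## §3 The chart equivalence -/

section Chart

variable {X S T : Scheme.{u}} (p : X ⟶ S) (I : X.IdealSheafData) (b : T ⟶ S)
  {W : S.Opens} (hW : IsAffineOpen W) {V' : T.Opens} (hV' : IsAffineOpen V') (hV'W : V' ≤ b ⁻¹ᵁ W)

/-- The chart `O := pr⁻¹(p⁻¹W) ∩ p_T⁻¹(V')` of `X ×_S T` lies over `p⁻¹W`.
[cite: GortzWedhorn2020, (4.5), Prop. 4.16 (pp. 101–104)] -/
theorem chart_le_preimage_fst :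
    pullback.fst p b ⁻¹ᵁ (p ⁻¹ᵁ W) ⊓ pullback.snd p b ⁻¹ᵁ V' ≤ pullback.fst p b ⁻¹ᵁ (p ⁻¹ᵁ W) :=
  inf_le_left

/-- The chart `O` lies over `V'`. [cite: GortzWedhorn2020, (4.5), Prop. 4.16 (pp. 101–104)] -/
theorem chart_le_preimage_snd :
    pullback.fst p b ⁻¹ᵁ (p ⁻¹ᵁ W) ⊓ pullback.snd p b ⁻¹ᵁ V' ≤ pullback.snd p b ⁻¹ᵁ V' :=
  inf_le_right

include hW hV' hV'W in
/-- **The chart equivalence.** For `p` affine, `W ⊆ S` affine with a frame `e : 𝒪^ι ≅ (p_*𝒪_X)|_W`, `V' ⊆ T` affine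
with `b(V') ⊆ W`, and `O := pr⁻¹(p⁻¹W) ∩ p_T⁻¹(V')`: the projection `pr^♯ : Γ(X, p⁻¹W) → Γ(X ×_S T, O)` kills `𝓘(p⁻¹W)`
iff `b^♯ : Γ(S, W) → Γ(T, V')` kills the ideal of values `V(u)(W)` of `u = p_*(𝓘_Z ↪ 𝒪_X)` (`Γ(O) = Γ(V') ⊗_{Γ(W)} Γ(p⁻¹W)`
by ★ `isPushout_sections_of_isPullback`; §1 in the frame). [cite: GortzWedhorn2020, (4.5), Prop. 4.16 (pp. 101–104)]
[cite: MumfordFogartyKirwan1994, Ch. 6 §3 Prop. 6.16 (p. 126)] -/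
theorem appLE_fst_eq_zero_iff_appLE_vanishingIdeal_eq_zero [IsAffineHom p] {ι : Type u} [Finite ι]
    (e : SheafOfModules.free ι ≅ ((Scheme.Modules.pushforward p).obj (unitModule X)).over W)
    (hE : IsAffineLocalizing ((Scheme.Modules.pushforward p).obj (idealSheafOf I.subschemeι)))
    (hV : IsAffineLocalizing (dual ((Scheme.Modules.pushforward p).obj (unitModule X)))) :
    (∀ x ∈ I.ideal ⟨p ⁻¹ᵁ W, hW.preimage p⟩,
        (pullback.fst p b).appLE (p ⁻¹ᵁ W) (pullback.fst p b ⁻¹ᵁ (p ⁻¹ᵁ W) ⊓ pullback.snd p b ⁻¹ᵁ V')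
          (chart_le_preimage_fst p b) x = 0) ↔
      ∀ y ∈ (vanishingIdeal ((Scheme.Modules.pushforward p).map (idealSheafOfι I.subschemeι))).ideal ⟨W, hW⟩,
        b.appLE W V' hV'W y = 0 := by
  classical
  -- the four rings of sections and the pushout square `Γ(O) = Γ(V') ⊗_{Γ(W)} Γ(p⁻¹W)`
  let O : (pullback p b).Opens := pullback.fst p b ⁻¹ᵁ (p ⁻¹ᵁ W) ⊓ pullback.snd p b ⁻¹ᵁ V'
  have hO : O = pullback.fst p b ⁻¹ᵁ (p ⁻¹ᵁ W) ⊓ pullback.snd p b ⁻¹ᵁ V' := rfl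
  letI algA' : Algebra Γ(S, W) Γ(T, V') := (b.appLE W V' hV'W).hom.toAlgebra
  letI algB : Algebra Γ(S, W) Γ(X, p ⁻¹ᵁ W) := (p.app W).hom.toAlgebra
  letI algBB' : Algebra Γ(X, p ⁻¹ᵁ W) Γ(pullback p b, O) :=
    ((pullback.fst p b).appLE (p ⁻¹ᵁ W) O (chart_le_preimage_fst p b)).hom.toAlgebra
  letI algA'B' : Algebra Γ(T, V') Γ(pullback p b, O) :=
    ((pullback.snd p b).appLE V' O (chart_le_preimage_snd p b)).hom.toAlgebra
  letI algAB' : Algebra Γ(S, W) Γ(pullback p b, O) :=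
    (b.appLE W V' hV'W ≫ (pullback.snd p b).appLE V' O (chart_le_preimage_snd p b)).hom.toAlgebra
  have happ : (p.app W).hom = (p.appLE W (p ⁻¹ᵁ W) le_rfl).hom := by rw [Scheme.Hom.appLE_eq_app]
  haveI : IsScalarTower Γ(S, W) Γ(T, V') Γ(pullback p b, O) :=
    IsScalarTower.of_algebraMap_eq fun r => rfl
  haveI : IsScalarTower Γ(S, W) Γ(X, p ⁻¹ᵁ W) Γ(pullback p b, O) :=
    IsScalarTower.of_algebraMap_eq fun r => by
      change (b.appLE W V' hV'W ≫ (pullback.snd p b).appLE V' O (chart_le_preimage_snd p b)) r =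
        (pullback.fst p b).appLE (p ⁻¹ᵁ W) O (chart_le_preimage_fst p b) ((p.app W).hom r)
      rw [happ, CommRingCat.comp_apply]
      exact (appLE_appLE_eq_of_comm_sq pullback.condition hV'W le_rfl hO r).symm
  haveI hpo : Algebra.IsPushout Γ(S, W) Γ(T, V') Γ(X, p ⁻¹ᵁ W) Γ(pullback p b, O) :=
    isPushout_sections_of_isPullback (IsPullback.of_hasPullback p b) hW hV' (hW.preimage p) hV'W le_rfl hO
      rfl happ rfl rfl
  -- LHS pointwise: `pr^♯(x) = 0 ↔ 1 ⊗ x = 0`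
  have hL : ∀ x : Γ(X, p ⁻¹ᵁ W),
      (pullback.fst p b).appLE (p ⁻¹ᵁ W) O (chart_le_preimage_fst p b) x = 0 ↔
        (1 : Γ(T, V')) ⊗ₜ[Γ(S, W)] x = 0 := by
    intro x
    rw [← Algebra.IsPushout.equiv_symm_algebraMap_right Γ(S, W) Γ(T, V') Γ(X, p ⁻¹ᵁ W) Γ(pullback p b, O) x,
      map_eq_zero_iff _ (Algebra.IsPushout.equiv _ _ _ _).symm.injective]
    rfl
  -- RHS: the ideal of `V(u)` on the affine `W` is generated by the values `μ_W(u_W s)`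
  have hR : (∀ y ∈ (vanishingIdeal ((Scheme.Modules.pushforward p).map (idealSheafOfι I.subschemeι))).ideal ⟨W, hW⟩,
        b.appLE W V' hV'W y = 0) ↔
      ∀ (s : Γ((Scheme.Modules.pushforward p).obj (idealSheafOf I.subschemeι), W))
        (μ : ((Scheme.Modules.pushforward p).obj (unitModule X)).over W ⟶ (unitModule S).over W),
        b.appLE W V' hV'W
          (appLE μ (𝟙 W) (((Scheme.Modules.pushforward p).map (idealSheafOfι I.subschemeι)).app W s)) = 0 := by
    rw [vanishingIdeal_ideal _ hE hV ⟨W, hW⟩]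
    refine ⟨fun h s μ => h _ (appLE_app_mem _ W s μ), fun h y hy => ?_⟩
    have hle : vanishingValueIdeal ((Scheme.Modules.pushforward p).map (idealSheafOfι I.subschemeι)) W ≤
        RingHom.ker (b.appLE W V' hV'W).hom := by
      refine Ideal.span_le.mpr ?_
      rintro _ ⟨⟨s, μ⟩, rfl⟩
      exact h s μ
    exact hle hy
  rw [hR]
  -- sections of `p_*𝓘_Z` over `W` are the elements of `𝓘(p⁻¹W)`
  have hker : I.subschemeι.ker.ideal ⟨p ⁻¹ᵁ W, hW.preimage p⟩ = I.ideal ⟨p ⁻¹ᵁ W, hW.preimage p⟩ := by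
    rw [Scheme.IdealSheafData.ker_subschemeι]
  constructor
  · intro h s μ
    -- `x := u_W(s) ∈ 𝓘(p⁻¹W)` has `1 ⊗ x = 0`; apply the functional `μ_W`
    have hxI : ((idealSheafOfι I.subschemeι).app (p ⁻¹ᵁ W) s : Γ(X, p ⁻¹ᵁ W)) ∈ I.ideal ⟨p ⁻¹ᵁ W, hW.preimage p⟩ :=
      hker ▸ idealSheafOfι_app_mem I.subschemeι (hW.preimage p) s
    have h1 := (hL _).1 (h _ hxI)
    -- `μ_W` as an `A`-linear functional on `B = Γ(X, p⁻¹W)`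
    let lam : Γ(X, p ⁻¹ᵁ W) →ₗ[Γ(S, W)] Γ(S, W) :=
      { toFun := fun x => (appLE μ (𝟙 W) (show Γ((Scheme.Modules.pushforward p).obj (unitModule X), W) from x) :
          Γ(S, W))
        map_add' := fun x y => appLE_add_right μ (𝟙 W) _ _
        map_smul' := fun r x => appLE_smul_right μ (𝟙 W) r _ }
    exact algebraMap_eq_zero_of_one_tmul_eq_zero lam _ h1
  · intro h x hx
    rw [hL]
    obtain ⟨m, rfl⟩ := exists_idealSheafOfι_app_eq_of_mem I.subschemeι (hW.preimage p)
      (show Γ(unitModule X, p ⁻¹ᵁ W) from x) (hker.symm ▸ hx)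
    -- expand `x` in the frame: `x = Σ λᵢ(x) bᵢ`, with `λᵢ(x)` values of the local functionals `λᵢ`
    letI := Fintype.ofFinite ι
    have hexp := eq_sum_coord_smul e (𝟙 W)
      (show Γ((Scheme.Modules.pushforward p).obj (unitModule X), W) from (idealSheafOfι I.subschemeι).app (p ⁻¹ᵁ W) m)
    refine one_tmul_eq_zero_of_eq_sum Finset.univ
      (fun i => coord e (𝟙 W)
        (show Γ((Scheme.Modules.pushforward p).obj (unitModule X), W) from (idealSheafOfι I.subschemeι).app (p ⁻¹ᵁ W) m) i)
      (fun i => (show Γ(X, p ⁻¹ᵁ W) from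
        ((Scheme.Modules.pushforward p).obj (unitModule X)).presheaf.map (𝟙 W).op (basisSection e i)))
      _ hexp fun i _ => h m (dualBasis e i)

end Chart

end Literature.AlgebraicGeometry.Morphisms

end
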